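import Summits.Ventures.PercRepro.PuncturedLYMTwoCoHypWeights

/-!
# PercRepro — TWO DISJOINT CO-HYPERPLANES, PART 7: POSITIVITY OF THE EXPLICIT FLOW, I — THE KEY ESTIMATE AND THE
EASY SIGNS (p10, gen 35)

Arithmetic only.  Towards the nonnegativity of the explicit flow of part 6 on `a < m₁`, `b < m₂`
(`2 ≤ m₁, m₂ ≤ j`, `j + 2 ≤ m₁ + m₂`, `2j + 1 ≤ n`):
* **the key estimate `coF_pred_bound`**: `b·f_{b−1}/(m + 1 − b) ≤ 1/C(m, b)` for `1 ≤ b < m` — by the row identity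
  at `b − 1` and the column identity at `b` the left side is `((j + 1 − b)·f_b − (j + 1)·δ)/(n − j − m + b − 1)`, by
  the exact solution this is at most `(j + 1 − b)·T_b/(n − j − m + b − 1)` with `T_b = V_b·Q_b/(C(m, b)·C(n, j))`, and
  `(j + 1 − b)·Q_b = (n − j − m + b − 1)·Q_{b−1}` (gen 33) turns it into `V_b·Q_{b−1}/(C(m, b)·C(n, j)) ≤ 1/C(m, b)`;
* `twoK_nonneg`, `twoK_le_one`, `cornerR_nonneg` (`twoK·(1/m₁ + 1/m₂) ≤ 1`);
* `supA_eq` / `supR_eq` (`(n − j)·supA = 1 + g¹_a − f²_b`, `(n − j)·supR = 1 − f¹_a − f²_b`), `supA_nonneg`,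
  `supB_nonneg` (`g ≥ 0`, `f ≤ 1`), `supR_nonneg` (`f ≤ 1/2`, part 5), `cBeta_nonneg`.
The layer `+R` weights and the assembly `w_nonneg` are part 7b (PuncturedLYMTwoCoHypPosLayer).  Nothing here asserts (SP).
-/

namespace PercRepro.PuncturedLYM

open Finset

/-- `V_c·Q_{c'}/(C(m, c)·C(n, j)) ≤ 1/C(m, c)` for `c ≤ m` and any `c'`. -/
theorem coVQ_le_inv_choose {n j m c c' : ℕ} (hmj : m ≤ j) (hn : 2 * j + 1 ≤ n) (hc : c ≤ m) :
    coV n j m c * coQ n j m c' / (((m.choose c : ℕ) : ℚ) * ((n.choose j : ℕ) : ℚ)) ≤ 1 / ((m.choose c : ℕ) : ℚ) := by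
  have hC : (0 : ℚ) < ((n.choose j : ℕ) : ℚ) := by exact_mod_cast Nat.choose_pos (by omega)
  have hB : (0 : ℚ) < ((m.choose c : ℕ) : ℚ) := by exact_mod_cast Nat.choose_pos hc
  have hV : coV n j m c ≤ ((n.choose j : ℕ) : ℚ) := by
    calc coV n j m c ≤ coP n j m := coV_le_coP hmj (by omega) hc
      _ ≤ ((n.choose j : ℕ) : ℚ) := by
          unfold coP
          have : (0 : ℚ) ≤ ((n - m).choose (j - m) : ℕ) := by positivity
          linarith
  have hQ := coQ_le_one (c := c') hmj hn
  have hQ0 := coQ_nonneg (c := c') hmj hn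
  have hV0 := coV_nonneg n j m c
  rw [div_le_div_iff₀ (mul_pos hB hC) hB]
  have : coV n j m c * coQ n j m c' ≤ ((n.choose j : ℕ) : ℚ) := by
    calc coV n j m c * coQ n j m c' ≤ ((n.choose j : ℕ) : ℚ) * 1 := mul_le_mul hV hQ hQ0 hC.le
      _ = ((n.choose j : ℕ) : ℚ) := by ring
  nlinarith

/-- **The key estimate**: `b·f_{b−1}/(m + 1 − b) ≤ 1/C(m, b)` for `1 ≤ b < m ≤ j`, `2j + 1 ≤ n`. -/
theorem coF_pred_bound {n j m b : ℕ} (hm : 1 ≤ m) (hmj : m ≤ j) (hn : 2 * j + 1 ≤ n) (hb1 : 1 ≤ b) (hb : b < m) :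
    (b : ℚ) * coF n j m (b - 1) / ((m + 1 - b : ℕ) : ℚ) ≤ 1 / ((m.choose b : ℕ) : ℚ) := by
  have hC : (0 : ℚ) < ((n.choose j : ℕ) : ℚ) := by exact_mod_cast Nat.choose_pos (by omega)
  have hB : (0 : ℚ) < ((m.choose b : ℕ) : ℚ) := by exact_mod_cast Nat.choose_pos hb.le
  have hrow := coF_row hm hmj hn (c := b - 1) (by omega)
  have hcol := coF_col hm hmj hn hb1 hb
  have hfeq := coF_eq hm hmj hn hb.le
  have hq := coQ_succ (n := n) (j := j) (m := m) (c := b - 1) hmj hn (by omega)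
  have hb1q : ((b - 1 : ℕ) : ℚ) = (b : ℚ) - 1 := by
    rw [Nat.cast_sub hb1]
    push_cast
    ring
  have hmb : ((m + 1 - b : ℕ) : ℚ) = (m : ℚ) + 1 - b := by
    rw [Nat.cast_sub (by omega)]
    push_cast
    ring
  have hE : ((n - j - m + (b - 1) : ℕ) : ℚ) = (n : ℚ) - j - m + ((b : ℚ) - 1) := by
    rw [Nat.cast_add, Nat.cast_sub (by omega), Nat.cast_sub (by omega), hb1q]
  have hjb : ((j - (b - 1) : ℕ) : ℚ) = (j : ℚ) + 1 - b := by
    rw [Nat.cast_sub (by omega), hb1q]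
    ring
  rw [hb1q] at hrow
  rw [hE, hjb] at hq
  rw [hmb]
  have hmb0 : (0 : ℚ) < (m : ℚ) + 1 - b := by
    have : (b : ℚ) + 1 ≤ m := by exact_mod_cast hb
    linarith
  have hE0 : (0 : ℚ) < (n : ℚ) - j - m + ((b : ℚ) - 1) := by
    have : (j : ℚ) + m + 1 ≤ n := by exact_mod_cast (show j + m + 1 ≤ n by omega)
    have : (1 : ℚ) ≤ b := by exact_mod_cast hb1
    linarith
  have hjb0 : (0 : ℚ) < (j : ℚ) + 1 - b := by
    have : (b : ℚ) + 1 ≤ m := by exact_mod_cast hb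
    have : (m : ℚ) ≤ j := by exact_mod_cast hmj
    linarith
  have hδ := coDel_nonneg n j m
  have hbq : (0 : ℚ) ≤ b := by positivity
  -- `b·f_{b−1}/(m + 1 − b) = b·g_{b−1}/E = ((j + 1 − b)·f_b − (j + 1)·δ)/E`
  have e1 : (b : ℚ) * coF n j m (b - 1) / ((m : ℚ) + 1 - b) =
      (((j : ℚ) + 1 - b) * coF n j m b - ((j : ℚ) + 1) * coDel n j m) / ((n : ℚ) - j - m + ((b : ℚ) - 1)) := by
    rw [div_eq_div_iff hmb0.ne' hE0.ne']
    have : ((m : ℚ) - ((b : ℚ) - 1)) = (m : ℚ) + 1 - b := by ring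
    rw [this] at hrow
    linear_combination (-(b : ℚ)) * hrow + ((m : ℚ) + 1 - b) * hcol
  -- `(j + 1 − b)·f_b − (j + 1)·δ ≤ (j + 1 − b)·T_b`
  set T := coV n j m b * coQ n j m b / (((m.choose b : ℕ) : ℚ) * ((n.choose j : ℕ) : ℚ)) with hT
  have e2 : ((j : ℚ) + 1 - b) * coF n j m b - ((j : ℚ) + 1) * coDel n j m ≤ ((j : ℚ) + 1 - b) * T := by
    rw [hfeq]
    nlinarith
  -- `(j + 1 − b)·T_b/E = V_b·Q_{b−1}/(C(m, b)·C(n, j))`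
  have hq' : coQ n j m b * ((j : ℚ) + 1 - b) = coQ n j m (b - 1) * ((n : ℚ) - j - m + ((b : ℚ) - 1)) := by
    have : b - 1 + 1 = b := by omega
    rw [this] at hq
    linear_combination -hq
  have e3 : ((j : ℚ) + 1 - b) * T / ((n : ℚ) - j - m + ((b : ℚ) - 1)) =
      coV n j m b * coQ n j m (b - 1) / (((m.choose b : ℕ) : ℚ) * ((n.choose j : ℕ) : ℚ)) := by
    calc ((j : ℚ) + 1 - b) * T / ((n : ℚ) - j - m + ((b : ℚ) - 1))
        = (coV n j m b * (coQ n j m b * ((j : ℚ) + 1 - b)) / (((m.choose b : ℕ) : ℚ) * ((n.choose j : ℕ) : ℚ))) /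
            ((n : ℚ) - j - m + ((b : ℚ) - 1)) := by rw [hT]; ring
      _ = (coV n j m b * (coQ n j m (b - 1) * ((n : ℚ) - j - m + ((b : ℚ) - 1))) /
            (((m.choose b : ℕ) : ℚ) * ((n.choose j : ℕ) : ℚ))) / ((n : ℚ) - j - m + ((b : ℚ) - 1)) := by rw [hq']
      _ = coV n j m b * coQ n j m (b - 1) / (((m.choose b : ℕ) : ℚ) * ((n.choose j : ℕ) : ℚ)) := by
          field_simp
  have e4 := coVQ_le_inv_choose (n := n) (j := j) (m := m) (c := b) (c' := b - 1) hmj hn hb.le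
  rw [e1]
  calc (((j : ℚ) + 1 - b) * coF n j m b - ((j : ℚ) + 1) * coDel n j m) / ((n : ℚ) - j - m + ((b : ℚ) - 1))
      ≤ ((j : ℚ) + 1 - b) * T / ((n : ℚ) - j - m + ((b : ℚ) - 1)) := by
        apply div_le_div_of_nonneg_right e2 hE0.le
    _ = coV n j m b * coQ n j m (b - 1) / (((m.choose b : ℕ) : ℚ) * ((n.choose j : ℕ) : ℚ)) := e3
    _ ≤ 1 / ((m.choose b : ℕ) : ℚ) := e4

/-- `0 ≤ twoK` (from `δ₁, δ₂ ≤ 1/4`). -/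
theorem twoK_nonneg {n j m₁ m₂ : ℕ} (hm₁ : 2 ≤ m₁) (hm₁j : m₁ ≤ j) (hm₂ : 2 ≤ m₂) (hm₂j : m₂ ≤ j)
    (hn : 2 * j + 1 ≤ n) : 0 ≤ twoK n j m₁ m₂ := by
  have hK := twoK_mul_r (m₁ := m₁) (m₂ := m₂) hn
  have hr : (0 : ℚ) < ((n - j : ℕ) : ℚ) := by
    have : 1 ≤ n - j := by omega
    exact_mod_cast this
  have h1 := coDel_mul_two_pow_le hm₁j hn
  have h2 := coDel_mul_two_pow_le hm₂j hn
  have h4 : (4 : ℚ) ≤ 2 ^ m₁ := by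
    calc (4 : ℚ) = 2 ^ 2 := by norm_num
      _ ≤ 2 ^ m₁ := pow_le_pow_right₀ (by norm_num) hm₁
  have h4' : (4 : ℚ) ≤ 2 ^ m₂ := by
    calc (4 : ℚ) = 2 ^ 2 := by norm_num
      _ ≤ 2 ^ m₂ := pow_le_pow_right₀ (by norm_num) hm₂
  have hδ1 := coDel_nonneg n j m₁
  have hδ2 := coDel_nonneg n j m₂
  have hd1 : coDel n j m₁ ≤ 1 / 4 := by nlinarith
  have hd2 : coDel n j m₂ ≤ 1 / 4 := by nlinarith
  have hj : (0 : ℚ) ≤ (j : ℚ) + 1 := by positivity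
  have hprod : 0 ≤ ((n - j : ℕ) : ℚ) * twoK n j m₁ m₂ := by
    rw [hK]
    apply mul_nonneg hj
    linarith
  by_contra hneg
  have : ((n - j : ℕ) : ℚ) * twoK n j m₁ m₂ < 0 := mul_neg_of_pos_of_neg hr (not_le.1 hneg)
  linarith

/-- `twoK ≤ 1`. -/
theorem twoK_le_one {n j m₁ m₂ : ℕ} (hn : 2 * j + 1 ≤ n) : twoK n j m₁ m₂ ≤ 1 := by
  have hK := twoK_mul_r (m₁ := m₁) (m₂ := m₂) hn
  have hr : (0 : ℚ) < ((n - j : ℕ) : ℚ) := by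
    have : 1 ≤ n - j := by omega
    exact_mod_cast this
  have hrj : (j : ℚ) + 1 ≤ ((n - j : ℕ) : ℚ) := by exact_mod_cast (show j + 1 ≤ n - j by omega)
  have hδ1 := coDel_nonneg n j m₁
  have hδ2 := coDel_nonneg n j m₂
  have hj : (0 : ℚ) ≤ (j : ℚ) + 1 := by positivity
  have : ((n - j : ℕ) : ℚ) * twoK n j m₁ m₂ ≤ ((n - j : ℕ) : ℚ) * 1 := by
    rw [hK, mul_one]
    calc ((j : ℚ) + 1) * (1 - coDel n j m₁ - coDel n j m₂) ≤ ((j : ℚ) + 1) * 1 := by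
          apply mul_le_mul_of_nonneg_left _ hj
          linarith
      _ ≤ ((n - j : ℕ) : ℚ) := by linarith
  exact le_of_mul_le_mul_left this hr

/-- The corner `+R` weight is nonnegative: `twoK·(1/m₁ + 1/m₂) ≤ 1`. -/
theorem cornerR_nonneg {n j m₁ m₂ : ℕ} (hm₁ : 2 ≤ m₁) (hm₁j : m₁ ≤ j) (hm₂ : 2 ≤ m₂) (hm₂j : m₂ ≤ j)
    (hn : 2 * j + 1 ≤ n) : 0 ≤ cornerR n j m₁ m₂ := by
  have hK0 := twoK_nonneg hm₁ hm₁j hm₂ hm₂j hn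
  have hK1 := twoK_le_one (m₁ := m₁) (m₂ := m₂) hn
  have hm₁q : (2 : ℚ) ≤ m₁ := by exact_mod_cast hm₁
  have hm₂q : (2 : ℚ) ≤ m₂ := by exact_mod_cast hm₂
  have h1 : twoK n j m₁ m₂ / (m₁ : ℚ) ≤ 1 / 2 := by
    rw [div_le_div_iff₀ (by linarith) (by norm_num)]
    nlinarith
  have h2 : twoK n j m₁ m₂ / (m₂ : ℚ) ≤ 1 / 2 := by
    rw [div_le_div_iff₀ (by linarith) (by norm_num)]
    nlinarith
  unfold cornerR
  apply div_nonneg _ (by positivity)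
  linarith

/-- `(n − j)·supA a b = 1 + g¹_a − f²_b`. -/
theorem supA_eq {n j m₁ m₂ a b : ℕ} (hn : 2 * j + 1 ≤ n) :
    ((n - j : ℕ) : ℚ) * supA n j m₁ m₂ a b = 1 + coG n j m₁ a - coF n j m₂ b := by
  have hr : ((n - j : ℕ) : ℚ) ≠ 0 := by
    have : 1 ≤ n - j := by omega
    exact_mod_cast (show n - j ≠ 0 by omega)
  unfold supA coG coF
  field_simp
  ring

/-- `(n − j)·supR a b = 1 − f¹_a − f²_b`. -/
theorem supR_eq {n j m₁ m₂ a b : ℕ} (hn : 2 * j + 1 ≤ n) :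
    ((n - j : ℕ) : ℚ) * supR n j m₁ m₂ a b = 1 - coF n j m₁ a - coF n j m₂ b := by
  have hr : ((n - j : ℕ) : ℚ) ≠ 0 := by
    have : 1 ≤ n - j := by omega
    exact_mod_cast (show n - j ≠ 0 by omega)
  unfold supR coF
  field_simp
  ring

/-- `supA a b ≥ 0` for `a < m₁`, `b < m₂`. -/
theorem supA_nonneg {n j m₁ m₂ a b : ℕ} (hm₁ : 1 ≤ m₁) (hm₁j : m₁ ≤ j) (hm₂ : 1 ≤ m₂) (hm₂j : m₂ ≤ j)
    (hn : 2 * j + 1 ≤ n) (ha : a < m₁) (hb : b < m₂) : 0 ≤ supA n j m₁ m₂ a b := by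
  have hr : (0 : ℚ) < ((n - j : ℕ) : ℚ) := by
    have : 1 ≤ n - j := by omega
    exact_mod_cast this
  have h := supA_eq (m₁ := m₁) (m₂ := m₂) (a := a) (b := b) hn
  have hg := coG_nonneg hm₁ hm₁j hn ha
  have hf := coF_le_one hm₂ hm₂j hn hb
  have hprod : 0 ≤ ((n - j : ℕ) : ℚ) * supA n j m₁ m₂ a b := by rw [h]; linarith
  by_contra hneg
  have : ((n - j : ℕ) : ℚ) * supA n j m₁ m₂ a b < 0 := mul_neg_of_pos_of_neg hr (not_le.1 hneg)
  linarith

/-- `supB a b ≥ 0` for `a < m₁`, `b < m₂`. -/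
theorem supB_nonneg {n j m₁ m₂ a b : ℕ} (hm₁ : 1 ≤ m₁) (hm₁j : m₁ ≤ j) (hm₂ : 1 ≤ m₂) (hm₂j : m₂ ≤ j)
    (hn : 2 * j + 1 ≤ n) (ha : a < m₁) (hb : b < m₂) : 0 ≤ supB n j m₁ m₂ a b := by
  rw [← supA_symm]
  exact supA_nonneg hm₂ hm₂j hm₁ hm₁j hn hb ha

/-- `supR a b ≥ 0` for `a < m₁`, `b < m₂` (`2 ≤ m₁, m₂`): `f¹_a + f²_b ≤ 1`. -/
theorem supR_nonneg {n j m₁ m₂ a b : ℕ} (hm₁ : 2 ≤ m₁) (hm₁j : m₁ ≤ j) (hm₂ : 2 ≤ m₂) (hm₂j : m₂ ≤ j)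
    (hn : 2 * j + 1 ≤ n) (ha : a < m₁) (hb : b < m₂) : 0 ≤ supR n j m₁ m₂ a b := by
  have hr : (0 : ℚ) < ((n - j : ℕ) : ℚ) := by
    have : 1 ≤ n - j := by omega
    exact_mod_cast this
  have h := supR_eq (m₁ := m₁) (m₂ := m₂) (a := a) (b := b) hn
  have h1 := coF_le_half hm₁ hm₁j hn ha
  have h2 := coF_le_half hm₂ hm₂j hn hb
  have hprod : 0 ≤ ((n - j : ℕ) : ℚ) * supR n j m₁ m₂ a b := by rw [h]; linarith
  by_contra hneg
  have : ((n - j : ℕ) : ℚ) * supR n j m₁ m₂ a b < 0 := mul_neg_of_pos_of_neg hr (not_le.1 hneg)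
  linarith

/-- `β_b ≥ 0` for `b ≤ m₂`. -/
theorem cBeta_nonneg {n j m₁ m₂ b : ℕ} (hm₂ : 1 ≤ m₂) (hm₂j : m₂ ≤ j) (hn : 2 * j + 1 ≤ n) (hb : b ≤ m₂) :
    0 ≤ cBeta n j m₁ m₂ b := by
  unfold cBeta
  apply div_nonneg
  · exact mul_nonneg (by positivity) (coF_nonneg hm₂ hm₂j hn hb)
  · positivity

end PercRepro.PuncturedLYM
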